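import Mathlib.Analysis.Complex.Basic
import Mathlib.Analysis.Complex.Conformal
import Mathlib.Analysis.Calculus.ContDiff.Operations
import Mathlib.Analysis.Calculus.FDeriv.Mul
import Mathlib.Topology.Connected.Basic
import Mathlib.Analysis.Calculus.FDeriv.Analytic
import Mathlib.Analysis.Normed.Ring.Units
import Mathlib.Topology.Algebra.Module.FiniteDimension
import HarnessLib

/-!
# Normalising a complex structure on the real plane to multiplication by `i`

A (linear) complex structure on `ℝ² = ℂ` is a real-linear `D : ℂ →L[ℝ] ℂ` with `D ∘ D = -1`.
Every such `D` is conjugate to multiplication by `I`: there is an invertible real-linear `Q` with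
`Q ∘ D = I • Q`. We give an EXPLICIT normaliser, uniform in `D`, which is the point of this file:

* `D 1` is never real (`im_apply_one_ne_zero`), and its imaginary part has the sign of the
  orientation induced by `D`;
* if `0 < (D 1).im` then `Q = 1 - I • D` works (`(I + D) v = 0` with `v ≠ 0` would force `D = -I`,
  whose `D 1 = -I` has negative imaginary part); if `(D 1).im < 0` then
  `Q = (1 - I • D̄) ∘ conj` with `D̄ = conj ∘ D ∘ conj` works;
* `normaliser D` chooses between the two by the sign, so that for a FAMILY `x ↦ D x` of complex
  structures depending smoothly on a parameter in a preconnected set the sign — hence the branch —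
  is constant, and `x ↦ normaliser (D x)` is smooth with a smooth two-sided inverse
  (`contDiffOn_normaliser_comp`, `contDiffOn_normaliserInv_comp`).

Use (lead of crux `WitnessCharge`, summit `SmoothPoincare4`): the complex structure induced by an
almost complex structure on the (trivial) normal bundle of an embedded `J`-holomorphic sphere,
read in a product chart, is normalised to `i` along the sphere before linearising the
Cauchy–Riemann operator (Wendl 2018, proof of Thm. 2.46 / §2.3, "choose a complex trivialisation
of the normal bundle").

## References

* C. Wendl, *Holomorphic Curves in Low Dimensions*, LNM 2216 (2018), §2.3. [Wendl2018]
-/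

noncomputable section

open Complex Set
open scoped ContDiff

namespace Literature.Geometry.Symplectic

namespace PlaneComplexStructure

/-- Complex conjugation as a real-linear self-map of `ℂ`. [folklore] -/
abbrev conjR : ℂ →L[ℝ] ℂ := conjCLE.toContinuousLinearMap

/-- Pointwise: `conjR z = conj z`. [folklore] -/
@[simp] theorem conjR_apply (z : ℂ) : conjR z = (starRingEnd ℂ) z := rfl

/-- The conjugate structure `D̄ = conj ∘ D ∘ conj`. [folklore] -/
def conjStr (D : ℂ →L[ℝ] ℂ) : ℂ →L[ℝ] ℂ := conjR.comp (D.comp conjR)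

/-- Pointwise formula for the conjugate structure. [folklore] -/
@[simp] theorem conjStr_apply (D : ℂ →L[ℝ] ℂ) (z : ℂ) :
    conjStr D z = (starRingEnd ℂ) (D ((starRingEnd ℂ) z)) := rfl

/-- Multiplication by `I` as a real-linear map. [folklore] -/
abbrev mulI : ℂ →L[ℝ] ℂ := (I • ContinuousLinearMap.id ℂ ℂ).restrictScalars ℝ

/-- Pointwise: `mulI z = I * z`. [folklore] -/
@[simp] theorem mulI_apply (z : ℂ) : mulI z = I * z := by simp [mulI]

/-- The positive-branch normaliser `1 - I • D`. [folklore] -/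
def posNormaliser (D : ℂ →L[ℝ] ℂ) : ℂ →L[ℝ] ℂ := ContinuousLinearMap.id ℝ ℂ - mulI.comp D

/-- Pointwise: `posNormaliser D z = z - I * D z`. [folklore] -/
@[simp] theorem posNormaliser_apply (D : ℂ →L[ℝ] ℂ) (z : ℂ) :
    posNormaliser D z = z - I * D z := by simp [posNormaliser]

/-- **The normaliser** of a complex structure `D` on the real plane: `1 - I • D` if `D` is
positively oriented (`0 < (D 1).im`), else `(1 - I • D̄) ∘ conj`. [cite: Wendl2018, §2.3] -/
def normaliser (D : ℂ →L[ℝ] ℂ) : ℂ →L[ℝ] ℂ :=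
  if 0 < (D 1).im then posNormaliser D else (posNormaliser (conjStr D)).comp conjR

/-! ### Algebra of a single complex structure -/

section Single

/-- For a complex structure `D` on `ℝ²`, `D 1` is not real. [folklore] -/
theorem im_apply_one_ne_zero {D : ℂ →L[ℝ] ℂ} (hD : ∀ z, D (D z) = -z) : (D 1).im ≠ 0 := by
  intro h
  -- `D 1 = r` real ⇒ `D (D 1) = r • D 1 = r²`, contradicting `D (D 1) = -1`
  set r : ℝ := (D 1).re with hr
  have h1 : D 1 = (r : ℂ) := Complex.ext (by simp [hr]) (by simp [h])
  have h2 : D (D 1) = (r : ℂ) * (r : ℂ) := by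
    rw [h1, show ((r : ℂ)) = (r : ℝ) • (1 : ℂ) by simp, D.map_smul, h1]
    simp
  have h3 : ((r : ℂ) * r) = -1 := by rw [← h2, hD]
  have h4 : (r * r : ℝ) = -1 := by exact_mod_cast h3
  nlinarith [mul_self_nonneg r]

/-- The conjugate structure is again a complex structure. [folklore] -/
theorem conjStr_conjStr {D : ℂ →L[ℝ] ℂ} (hD : ∀ z, D (D z) = -z) (z : ℂ) :
    conjStr D (conjStr D z) = -z := by
  simp [hD]

/-- The conjugate structure has the opposite sign: `(D̄ 1).im = -(D 1).im`. [folklore] -/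
theorem im_conjStr_apply_one (D : ℂ →L[ℝ] ℂ) : (conjStr D 1).im = -(D 1).im := by
  simp

/-- Key injectivity: if `D` is positively oriented then `z - I * D z = 0` forces `z = 0`.
[folklore] -/
theorem posNormaliser_injective {D : ℂ →L[ℝ] ℂ} (hD : ∀ z, D (D z) = -z) (hpos : 0 < (D 1).im) :
    Function.Injective (posNormaliser D) := by
  refine (injective_iff_map_eq_zero (posNormaliser D)).2 fun v hv => ?_
  rw [posNormaliser_apply, sub_eq_zero] at hv
  -- `hv : v = I * D v`, i.e. `D v = -I * v`; then `D (I * v) = -I * (I * v)` too, so `D = -I•` on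
  -- the real span of `v, I v`, which is everything if `v ≠ 0`; then `D 1 = -I`, contradiction.
  by_contra hv0
  have hDv : D v = -I * v := by
    have := congrArg (fun x => -I * x) hv
    rw [← mul_assoc, show (-I) * I = 1 by rw [neg_mul, I_mul_I, neg_neg], one_mul] at this
    exact this.symm
  have hDIv : D (I * v) = -I * (I * v) := by
    -- apply `D` to `D v = -I v`: `-v = D (-I v)`; real-linearity only gives `D (-I v)` via `D (D v)`
    have h := congrArg D hDv
    rw [hD] at h
    -- `h : -v = D (-I * v)`
    have h' : D (I * v) = v := by
      have : D (-(I * v)) = -v := by rw [← neg_mul]; exact h.symm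
      rwa [map_neg, neg_inj] at this
    rw [h', ← mul_assoc, show (-I) * I = 1 by rw [neg_mul, I_mul_I, neg_neg], one_mul]
  -- express `1` in the real basis `v, I v`
  obtain ⟨a, b, hab⟩ : ∃ a b : ℝ, (1 : ℂ) = a • v + b • (I * v) := by
    refine ⟨(v⁻¹).re, (v⁻¹).im, ?_⟩
    have hvinv : (1 : ℂ) = v⁻¹ * v := (inv_mul_cancel₀ hv0).symm
    conv_lhs => rw [hvinv, ← re_add_im v⁻¹]
    simp [add_mul, mul_assoc, Complex.real_smul]
  have hD1 : D 1 = -I := by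
    rw [hab, map_add, D.map_smul, D.map_smul, hDv, hDIv]
    have : a • (-I * v) + b • (-I * (I * v)) = -I * (a • v + b • (I * v)) := by
      simp [Complex.real_smul]; ring
    rw [this, ← hab, mul_one]
  have : (D 1).im = -1 := by rw [hD1]; simp
  linarith

/-- The positive-branch normaliser intertwines `D` with multiplication by `I`. [folklore] -/
theorem posNormaliser_apply_D {D : ℂ →L[ℝ] ℂ} (hD : ∀ z, D (D z) = -z) (z : ℂ) :
    posNormaliser D (D z) = I * posNormaliser D z := by
  simp only [posNormaliser_apply, hD, mul_neg, sub_neg_eq_add, mul_sub, ← mul_assoc, I_mul_I,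
    neg_one_mul, sub_neg_eq_add]
  ring

/-- **The normaliser intertwines `D` with multiplication by `I`.** [cite: Wendl2018, §2.3] -/
theorem normaliser_apply_D {D : ℂ →L[ℝ] ℂ} (hD : ∀ z, D (D z) = -z) (z : ℂ) :
    normaliser D (D z) = I * normaliser D z := by
  unfold normaliser
  split_ifs with h
  · exact posNormaliser_apply_D hD z
  · simp only [ContinuousLinearMap.comp_apply, conjR_apply]
    have hD' : ∀ z, conjStr D (conjStr D z) = -z := conjStr_conjStr hD
    have key := posNormaliser_apply_D hD' ((starRingEnd ℂ) z)
    simp only [conjStr_apply, Complex.conj_conj] at key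
    exact key

/-- **The normaliser is injective**, hence (finite dimension) bijective. [folklore] -/
theorem normaliser_injective {D : ℂ →L[ℝ] ℂ} (hD : ∀ z, D (D z) = -z) :
    Function.Injective (normaliser D) := by
  unfold normaliser
  split_ifs with h
  · exact posNormaliser_injective hD h
  · have hne := im_apply_one_ne_zero hD
    have hneg : (D 1).im < 0 := lt_of_le_of_ne (not_lt.1 h) hne
    have hD' : ∀ z, conjStr D (conjStr D z) = -z := conjStr_conjStr hD
    have hpos' : 0 < (conjStr D 1).im := by rw [im_conjStr_apply_one]; linarith
    exact (posNormaliser_injective hD' hpos').comp conjCLE.injective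

/-- The normaliser is bijective. [folklore] -/
theorem normaliser_bijective {D : ℂ →L[ℝ] ℂ} (hD : ∀ z, D (D z) = -z) :
    Function.Bijective (normaliser D) :=
  ⟨normaliser_injective hD,
    LinearMap.surjective_of_injective (f := (normaliser D : ℂ →ₗ[ℝ] ℂ)) (normaliser_injective hD)⟩

/-- The normaliser as a continuous linear equivalence. [folklore] -/
def normaliserEquiv {D : ℂ →L[ℝ] ℂ} (hD : ∀ z, D (D z) = -z) : ℂ ≃L[ℝ] ℂ :=
  (LinearEquiv.ofBijective (normaliser D : ℂ →ₗ[ℝ] ℂ) (normaliser_bijective hD)).toContinuousLinearEquiv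

/-- The normaliser equivalence applied. [folklore] -/
@[simp] theorem normaliserEquiv_apply {D : ℂ →L[ℝ] ℂ} (hD : ∀ z, D (D z) = -z) (z : ℂ) :
    normaliserEquiv hD z = normaliser D z := rfl

/-- The normaliser equivalence coerces to the normaliser. [folklore] -/
@[simp] theorem coe_normaliserEquiv {D : ℂ →L[ℝ] ℂ} (hD : ∀ z, D (D z) = -z) :
    (normaliserEquiv hD : ℂ →L[ℝ] ℂ) = normaliser D := by
  ext z; rfl

/-- Conjugation formula: `Q D Q⁻¹ = I •`. [cite: Wendl2018, §2.3] -/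
theorem normaliser_conj {D : ℂ →L[ℝ] ℂ} (hD : ∀ z, D (D z) = -z) (z : ℂ) :
    normaliser D (D ((normaliserEquiv hD).symm z)) = I * z := by
  rw [normaliser_apply_D hD, ← normaliserEquiv_apply hD, ContinuousLinearEquiv.apply_symm_apply]

end Single

/-! ### Smooth families -/

section Family

variable {E : Type*} [NormedAddCommGroup E]

/-- `D ↦ 1 - I • D` is a continuous affine, hence smooth, map of `D`. [folklore] -/
theorem contDiff_posNormaliser : ContDiff ℝ ∞ (fun D : ℂ →L[ℝ] ℂ => posNormaliser D) := by
  unfold posNormaliser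
  exact contDiff_const.sub ((ContinuousLinearMap.compL ℝ ℂ ℂ ℂ mulI).contDiff)

/-- `D ↦ D̄` is continuous linear, hence smooth. [folklore] -/
theorem contDiff_conjStr : ContDiff ℝ ∞ (fun D : ℂ →L[ℝ] ℂ => conjStr D) := by
  have h1 : ContDiff ℝ ∞ (fun D : ℂ →L[ℝ] ℂ => D.comp conjR) :=
    ((ContinuousLinearMap.compL ℝ ℂ ℂ ℂ).flip conjR).contDiff
  exact (ContinuousLinearMap.compL ℝ ℂ ℂ ℂ conjR).contDiff.comp h1

/-- On a preconnected set, a continuous family of complex structures has constant orientation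
sign. [folklore] -/
theorem sign_const {s : Set E} (hs : IsPreconnected s) {D : E → ℂ →L[ℝ] ℂ}
    (hDc : ContinuousOn D s) (hD : ∀ x ∈ s, ∀ z, D x (D x z) = -z) {x y : E} (hx : x ∈ s)
    (hy : y ∈ s) (hpos : 0 < (D x 1).im) : 0 < (D y 1).im := by
  have hcont : ContinuousOn (fun x => (D x 1).im) s :=
    Complex.continuous_im.comp_continuousOn ((ContinuousLinearMap.apply ℝ ℂ (1 : ℂ)).continuous
      |>.comp_continuousOn hDc)
  have hne : ∀ z ∈ s, (fun x => (D x 1).im) z ≠ 0 := fun z hz => im_apply_one_ne_zero (hD z hz)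
  -- the image is a preconnected subset of `ℝ ∖ {0}` containing a positive number
  by_contra hneg
  have hyneg : (D y 1).im < 0 := lt_of_le_of_ne (not_lt.1 hneg) (hne y hy)
  obtain ⟨z, hz, hz0⟩ := hs.intermediate_value₂ hy hx hcont continuousOn_const hyneg.le hpos.le
  exact hne z hz hz0

/-- **Smoothness of the normaliser of a smooth family** of complex structures on a preconnected
set: the branch is constant there. [cite: Wendl2018, §2.3] -/
theorem contDiffOn_normaliser_comp [NormedSpace ℝ E] {s : Set E} (hs : IsPreconnected s) {D : E → ℂ →L[ℝ] ℂ}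
    {n : ℕ∞} (hDs : ContDiffOn ℝ n D s) (hD : ∀ x ∈ s, ∀ z, D x (D x z) = -z) :
    ContDiffOn ℝ n (fun x => normaliser (D x)) s := by
  rcases s.eq_empty_or_nonempty with rfl | ⟨x₀, hx₀⟩
  · exact contDiffOn_empty
  by_cases h0 : 0 < (D x₀ 1).im
  · have hall : ∀ x ∈ s, 0 < (D x 1).im := fun x hx =>
      sign_const hs hDs.continuousOn hD hx₀ hx h0
    refine ((contDiff_posNormaliser.of_le (by exact_mod_cast le_top)).comp_contDiffOn hDs).congr fun x hx => ?_
    simp [normaliser, hall x hx]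
  · have hall : ∀ x ∈ s, ¬ 0 < (D x 1).im := fun x hx hx' =>
      h0 (sign_const hs hDs.continuousOn hD hx hx₀ hx')
    have h2 : ContDiffOn ℝ n (fun x => (posNormaliser (conjStr (D x))).comp conjR) s :=
      (((ContinuousLinearMap.compL ℝ ℂ ℂ ℂ).flip conjR).contDiff.of_le (by exact_mod_cast le_top)).comp_contDiffOn
        ((contDiff_posNormaliser.of_le (by exact_mod_cast le_top)).comp_contDiffOn
          ((contDiff_conjStr.of_le (by exact_mod_cast le_top)).comp_contDiffOn hDs))
    refine h2.congr fun x hx => ?_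
    simp [normaliser, hall x hx]

/-- The normaliser of a complex structure is a unit of the algebra `ℂ →L[ℝ] ℂ`. [folklore] -/
theorem isUnit_normaliser {D : ℂ →L[ℝ] ℂ} (hD : ∀ z, D (D z) = -z) : IsUnit (normaliser D) :=
  ⟨ContinuousLinearEquiv.toUnit (normaliserEquiv hD), rfl⟩

/-- **The inverse of the normaliser of a smooth family is smooth** (inversion is smooth on the
units of the Banach algebra `ℂ →L[ℝ] ℂ`), with the two-sided inverse identities. [folklore] -/
theorem contDiffOn_inverse_normaliser_comp [NormedSpace ℝ E] {s : Set E} (hs : IsPreconnected s)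
    {D : E → ℂ →L[ℝ] ℂ} {n : ℕ∞} (hDs : ContDiffOn ℝ n D s)
    (hD : ∀ x ∈ s, ∀ z, D x (D x z) = -z) :
    ContDiffOn ℝ n (fun x => Ring.inverse (normaliser (D x))) s ∧
      ∀ x ∈ s, (Ring.inverse (normaliser (D x))) * normaliser (D x) = 1 ∧
        normaliser (D x) * Ring.inverse (normaliser (D x)) = 1 := by
  refine ⟨fun x hx => ?_, fun x hx => ?_⟩
  · have hu : IsUnit (normaliser (D x)) := isUnit_normaliser (hD x hx)
    obtain ⟨u, hu'⟩ := hu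
    have h1 : ContDiffAt ℝ n Ring.inverse (normaliser (D x)) := by
      rw [← hu']
      exact contDiffAt_ringInverse ℝ u
    exact h1.comp_contDiffWithinAt x (contDiffOn_normaliser_comp hs hDs hD x hx)
  · have hu : IsUnit (normaliser (D x)) := isUnit_normaliser (hD x hx)
    exact ⟨Ring.inverse_mul_cancel _ hu, Ring.mul_inverse_cancel _ hu⟩

end Family

end PlaneComplexStructure

end Literature.Geometry.Symplectic

end
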